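import Literature.Analysis.FluidPDE.TorusClassicalNSTimeDerivative
import HarnessLib

/-!
# The time derivative of a classical Navier–Stokes solution on the flat torus solves the
# linearised equation

Analysis/FluidPDE proof file (theorems only; no definitions, no named facts). For a classical
solution `(u, p)` of the forced incompressible Navier–Stokes system on `[a, b] × T^d`
(`Torus.IsClassicalNSSolutionOn (Icc a b) ν f u p`, `a < b`), the one-sided time derivatives
`w := ∂ₜu = Torus.timeDerivWithin (Icc a b) u`, `q := ∂ₜp` satisfy the **linearised Navier–Stokes
equation along `u`, forced by `∂ₜf`**:

  `∂ₜw + (u·∇)w + (w·∇)u = νΔw − ∇q + ∂ₜf`,  `div w = 0`,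

(`Torus.IsClassicalNSSolutionOn.linearised_timeDerivWithin`; for a steady force the forcing term is
absent, `Torus.IsClassicalNSSolutionOn.linearised_timeDerivWithin_of_steady`), `w`, `q` (and `f`)
are jointly smooth on `[a, b] × T^d` (`Torus.IsClassicalNSSolutionOn.smooth_force`,
`Torus.IsSmoothSpaceTimeOn.timeDerivWithin`), and `w(t)` has zero mean whenever all slices `u(t)` do
(`Torus.IsSmoothSpaceTimeOn.hasZeroMean_timeDerivWithin`: `∫ ∂ₜu = d/dt ∫ u = 0`). This is the
classical statement "`u' = du/dt` solves the first variation equation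
`U' + νAU + B(u, U) + B(U, u) = f'`" (Temam, *Navier–Stokes Equations and Nonlinear Functional
Analysis*, 2nd ed. 1995, Part I §3.4, proof of Thm. 3.2, eq. (3.39); Constantin–Foias 1988, Ch. 10,
the a priori estimates for `∂ₜu`): the flow direction `∂ₜu` is a solution of the derivative
cocycle of the Navier–Stokes semiflow, the fact behind "the flow direction is a Lyapunov direction
with exponent `0`" for invariant sets of strong solutions.

The proof differentiates the momentum equation `∂ₜu = νΔu − ∇p + f − (u·∇)u` in `t` within
`[a, b]` at fixed `x`: `∂ₜ` commutes with `Δ` (`Torus.timeDerivWithin_laplacian_comm`), with `∇`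
(`Torus.timeDerivWithin_gradient_comm`, from `∂ₜ∂ⱼ = ∂ⱼ∂ₜ`), and obeys the Leibniz rule on the
bilinear convective term (`Torus.timeDerivWithin_convect`: `∂ₜ((w·∇)v) = (∂ₜw·∇)v + (w·∇)∂ₜv`, via
`(w·∇)v = ∑ᵢ wᵢ ∂ᵢv`). One-sided derivatives within `[a, b]` are unique (`uniqueDiffOn_Icc`).

## Mathlib / tree search

Tree (reused): `Torus.timeDerivWithin_partialDeriv_comm`, `Torus.timeDerivWithin_laplacian_comm`
(`TorusInverseLaplacianCalculus`), `Torus.IsSmoothSpaceTimeOn.hasDerivWithinAt_slice`,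
`….hasDerivWithinAt_integral` (`TorusCalculusProofs`), `Torus.IsSmoothSpaceTimeOn.timeDerivWithin`,
`….partialDeriv/laplacian/convect/gradient`, `Torus.gradient_eq_sum_partialDeriv` (`TorusSpaceTime`),
`Torus.convect_eq_sum_smul_partialDeriv` (`TorusEnstrophyOrthogonality`),
`Torus.IsClassicalNSSolutionOn.isDivFree_timeDerivWithin` (`TorusClassicalNSTimeDerivative`).
Searched `timeDerivWithin_convect`, `gradient (timeDerivWithin`, `linearised_timeDerivWithin`:
only a `T³`-local `∂ₜ∇ = ∇∂ₜ` inside `JetStressAlgebra` (`JetStep.Datum`, not importable here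
without the convex-integration stack) and `hasZeroMean_timeDerivWithin_univ` (time set `univ`,
`TorusForceBookkeeping`). Mathlib: `HasDerivWithinAt.smul`, `HasDerivWithinAt.fun_sum`,
`HasDerivWithinAt.derivWithin`, `UniqueDiffWithinAt.eq_deriv`.

## References

* R. Temam, *Navier–Stokes Equations and Nonlinear Functional Analysis*, 2nd ed., CBMS-NSF 66,
  SIAM 1995, Part I §3.4, proof of Thm. 3.2, (3.39) (the equation for `u' = du/dt`).
* P. Constantin, C. Foias, *Navier–Stokes Equations*, Univ. Chicago Press 1988, Ch. 10
  (estimates for `du/dt` by differentiating the equation in time). [ConstantinFoiasNSE1988]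
-/

noncomputable section

open MeasureTheory Set Function Filter
open scoped ContDiff InnerProductSpace RealInnerProductSpace Topology

namespace Literature.Analysis.FluidPDE

open Literature.Analysis.FunctionSpaces

variable {d : Type*} [Fintype d] [DecidableEq d]

/-! ## Space–time calculus: `∂ₜ∇ = ∇∂ₜ`, Leibniz rule for `(w·∇)v`, mean of `∂ₜu` -/

section Calculus

variable {F : Type*} [NormedAddCommGroup F] [NormedSpace ℝ F] {a b : ℝ}

/-- **`∂ₜ∇ = ∇∂ₜ` for jointly smooth scalar fields on `[a, b] × T^d`** (one-sided in time at the
endpoints): `∇θ = ∑ᵢ ∂ᵢθ eᵢ` and `∂ₜ∂ᵢ = ∂ᵢ∂ₜ` (`Torus.timeDerivWithin_partialDeriv_comm`). [folklore] -/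
theorem _root_.Literature.Analysis.FunctionSpaces.Torus.timeDerivWithin_gradient_comm (hab : a < b)
    {θ : ℝ → UnitAddTorus d → ℝ} (hθ : Torus.IsSmoothSpaceTimeOn (Icc a b) θ) {t : ℝ}
    (ht : t ∈ Icc a b) (x : UnitAddTorus d) :
    Torus.timeDerivWithin (Icc a b) (fun s => Torus.gradient (θ s)) t x =
      Torus.gradient (Torus.timeDerivWithin (Icc a b) θ t) x := by
  have hS : UniqueDiffOn ℝ (Icc a b) := uniqueDiffOn_Icc hab
  have h1 : ∀ s ∈ Icc a b, Torus.IsContDiff 1 (θ s) := fun s hs => (hθ.isSmooth_slice hs).isContDiff (by simp)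
  have h1t : Torus.IsContDiff 1 (Torus.timeDerivWithin (Icc a b) θ t) :=
    ((hθ.timeDerivWithin hS).isSmooth_slice ht).isContDiff (by simp)
  have hD : ∀ i, HasDerivWithinAt (fun s => Torus.partialDeriv i (θ s) x • EuclideanSpace.single i (1 : ℝ))
      (Torus.partialDeriv i (Torus.timeDerivWithin (Icc a b) θ t) x • EuclideanSpace.single i (1 : ℝ))
      (Icc a b) t := by
    intro i
    have h := ((hθ.partialDeriv hS i).hasDerivWithinAt_slice ht x).smul_const (EuclideanSpace.single i (1 : ℝ))
    rwa [Torus.timeDerivWithin_partialDeriv_comm hab hθ ht i x] at h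
  have key : HasDerivWithinAt (fun s => Torus.gradient (θ s) x)
      (Torus.gradient (Torus.timeDerivWithin (Icc a b) θ t) x) (Icc a b) t := by
    rw [Torus.gradient_eq_sum_partialDeriv h1t x]
    exact (HasDerivWithinAt.fun_sum (u := Finset.univ) fun i _ => hD i).congr
      (fun s hs => Torus.gradient_eq_sum_partialDeriv (h1 s hs) x)
      (Torus.gradient_eq_sum_partialDeriv (h1 t ht) x)
  exact key.derivWithin (hS t ht)

/-- **Leibniz rule for the convective term**: for jointly smooth `w` (vector field) and `v` on
`[a, b] × T^d`, `∂ₜ((w·∇)v) = (∂ₜw·∇)v + (w·∇)(∂ₜv)` (one-sided in time at the endpoints):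
`(w·∇)v = ∑ᵢ wᵢ ∂ᵢv`, the product rule, and `∂ₜ∂ᵢ = ∂ᵢ∂ₜ`. [folklore] -/
theorem _root_.Literature.Analysis.FunctionSpaces.Torus.timeDerivWithin_convect (hab : a < b)
    {w : ℝ → UnitAddTorus d → EuclideanSpace ℝ d} {v : ℝ → UnitAddTorus d → F}
    (hw : Torus.IsSmoothSpaceTimeOn (Icc a b) w) (hv : Torus.IsSmoothSpaceTimeOn (Icc a b) v)
    {t : ℝ} (ht : t ∈ Icc a b) (x : UnitAddTorus d) :
    Torus.timeDerivWithin (Icc a b) (fun s => Torus.convect (w s) (v s)) t x =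
      Torus.convect (Torus.timeDerivWithin (Icc a b) w t) (v t) x +
        Torus.convect (w t) (Torus.timeDerivWithin (Icc a b) v t) x := by
  have hS : UniqueDiffOn ℝ (Icc a b) := uniqueDiffOn_Icc hab
  have h1 : ∀ s ∈ Icc a b, Torus.IsContDiff 1 (v s) := fun s hs => (hv.isSmooth_slice hs).isContDiff (by simp)
  have h1t : Torus.IsContDiff 1 (Torus.timeDerivWithin (Icc a b) v t) :=
    ((hv.timeDerivWithin hS).isSmooth_slice ht).isContDiff (by simp)
  -- each summand `s ↦ wᵢ(s, x) • ∂ᵢv(s, x)`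
  have hD : ∀ i, HasDerivWithinAt (fun s => w s x i • Torus.partialDeriv i (v s) x)
      (w t x i • Torus.partialDeriv i (Torus.timeDerivWithin (Icc a b) v t) x +
        Torus.timeDerivWithin (Icc a b) w t x i • Torus.partialDeriv i (v t) x) (Icc a b) t := by
    intro i
    have hwi : HasDerivWithinAt (fun s => w s x i) (Torus.timeDerivWithin (Icc a b) w t x i) (Icc a b) t :=
      ((EuclideanSpace.proj i : EuclideanSpace ℝ d →L[ℝ] ℝ).hasFDerivAt.comp_hasDerivWithinAt t
        (hw.hasDerivWithinAt_slice ht x))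
    have hvi : HasDerivWithinAt (fun s => Torus.partialDeriv i (v s) x)
        (Torus.partialDeriv i (Torus.timeDerivWithin (Icc a b) v t) x) (Icc a b) t := by
      have h := (hv.partialDeriv hS i).hasDerivWithinAt_slice ht x
      rwa [Torus.timeDerivWithin_partialDeriv_comm hab hv ht i x] at h
    exact hwi.smul hvi
  have key : HasDerivWithinAt (fun s => Torus.convect (w s) (v s) x)
      (Torus.convect (Torus.timeDerivWithin (Icc a b) w t) (v t) x +
        Torus.convect (w t) (Torus.timeDerivWithin (Icc a b) v t) x) (Icc a b) t := by
    rw [Torus.convect_eq_sum_smul_partialDeriv (h1 t ht), Torus.convect_eq_sum_smul_partialDeriv h1t,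
      add_comm, ← Finset.sum_add_distrib]
    exact (HasDerivWithinAt.fun_sum (u := Finset.univ) fun i _ => hD i).congr
      (fun s hs => Torus.convect_eq_sum_smul_partialDeriv (h1 s hs) x)
      (Torus.convect_eq_sum_smul_partialDeriv (h1 t ht) x)
  exact key.derivWithin (hS t ht)

omit [DecidableEq d] in
/-- **The time derivative of a field with mean-zero slices has mean zero**: for `u` jointly smooth
on `[a, b] × T^d` with `∫ u(s) = 0` for all `s ∈ [a, b]`, `∫ ∂ₜu(t) = d/dt|ₜ ∫ u = 0`
(differentiation under `∫_{T^d}`, `Torus.IsSmoothSpaceTimeOn.hasDerivWithinAt_integral`, and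
uniqueness of one-sided derivatives within `[a, b]`). [folklore] -/
theorem _root_.Literature.Analysis.FunctionSpaces.Torus.IsSmoothSpaceTimeOn.hasZeroMean_timeDerivWithin
    (hab : a < b) {u : ℝ → UnitAddTorus d → F} (hu : Torus.IsSmoothSpaceTimeOn (Icc a b) u)
    (hmean : ∀ s ∈ Icc a b, Torus.HasZeroMean (u s)) {t : ℝ} (ht : t ∈ Icc a b) :
    Torus.HasZeroMean (Torus.timeDerivWithin (Icc a b) u t) := by
  have h1 := hu.hasDerivWithinAt_integral (convex_Icc a b) ht
  have h0 : HasDerivWithinAt (fun s => ∫ x, u s x) (0 : F) (Icc a b) t :=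
    (hasDerivWithinAt_const t (Icc a b) (0 : F)).congr (fun s hs => hmean s hs) (hmean t ht)
  exact (uniqueDiffOn_Icc hab t ht).eq_deriv _ h1 h0

end Calculus

/-! ## Classical solutions: the force is smooth, and `∂ₜu` solves the linearised equation -/

section NS

variable {a b ν : ℝ} {f u : ℝ → UnitAddTorus d → EuclideanSpace ℝ d} {p : ℝ → UnitAddTorus d → ℝ}

/-- **The force of a classical solution is jointly smooth** on any time set of unique
differentiability: `f = ∂ₜu + (u·∇)u − νΔu + ∇p` on `S × T^d`, a combination of jointly smooth
fields. [folklore] -/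
theorem _root_.Literature.Analysis.FunctionSpaces.Torus.IsClassicalNSSolutionOn.smooth_force {S : Set ℝ}
    (h : Torus.IsClassicalNSSolutionOn S ν f u p) (hS : UniqueDiffOn ℝ S) :
    Torus.IsSmoothSpaceTimeOn S f := by
  have hu : Torus.IsSmoothSpaceTimeOn S u := h.smooth_velocity
  have hE : Torus.IsSmoothSpaceTimeOn S (fun t x => Torus.timeDerivWithin S u t x +
      Torus.convect (u t) (u t) x - ν • Torus.laplacian (u t) x + Torus.gradient (p t) x) :=
    (((hu.timeDerivWithin hS).add (hu.convect hu hS)).sub ((hu.laplacian hS).const_smul ν)).add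
      (h.smooth_pressure.gradient hS)
  refine ContDiffOn.congr hE fun z hz => ?_
  obtain ⟨t, y⟩ := z
  have ht : t ∈ S := (mem_prod.1 hz).1
  simp only [Torus.stLift_apply]
  rw [h.momentum t ht (Torus.proj y)]
  abel

/-- **`∂ₜu` solves the linearised Navier–Stokes equation forced by `∂ₜf`.** For a classical
solution on `[a, b] × T^d`, `a < b`, `t ∈ [a, b]` and `x ∈ T^d`, with `w = ∂ₜu`, `q = ∂ₜp`
(one-sided time derivatives within `[a, b]`):
`∂ₜw + (u·∇)w + (w·∇)u = νΔw − ∇q + ∂ₜf` at `(t, x)` — differentiate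
`∂ₜu = νΔu − ∇p + f − (u·∇)u` in `t` (`∂ₜΔ = Δ∂ₜ`, `∂ₜ∇ = ∇∂ₜ`, Leibniz on `(u·∇)u`).
[cite: ConstantinFoiasNSE1988, Ch. 10] -/
theorem _root_.Literature.Analysis.FunctionSpaces.Torus.IsClassicalNSSolutionOn.linearised_timeDerivWithin
    (h : Torus.IsClassicalNSSolutionOn (Icc a b) ν f u p) (hab : a < b) {t : ℝ} (ht : t ∈ Icc a b)
    (x : UnitAddTorus d) :
    Torus.timeDerivWithin (Icc a b) (Torus.timeDerivWithin (Icc a b) u) t x +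
        Torus.convect (u t) (Torus.timeDerivWithin (Icc a b) u t) x +
        Torus.convect (Torus.timeDerivWithin (Icc a b) u t) (u t) x =
      ν • Torus.laplacian (Torus.timeDerivWithin (Icc a b) u t) x -
        Torus.gradient (Torus.timeDerivWithin (Icc a b) p t) x + Torus.timeDerivWithin (Icc a b) f t x := by
  have hS : UniqueDiffOn ℝ (Icc a b) := uniqueDiffOn_Icc hab
  have hu : Torus.IsSmoothSpaceTimeOn (Icc a b) u := h.smooth_velocity
  have hp : Torus.IsSmoothSpaceTimeOn (Icc a b) p := h.smooth_pressure
  have hf : Torus.IsSmoothSpaceTimeOn (Icc a b) f := h.smooth_force hS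
  set S : Set ℝ := Icc a b with hSdef
  set w := Torus.timeDerivWithin S u with hwdef
  -- the right-hand side `νΔu − ∇p + f − (u·∇)u` is differentiable in `t` within `S`, slice-wise
  have hL : HasDerivWithinAt (fun s => Torus.laplacian (u s) x) (Torus.laplacian (w t) x) S t := by
    have h1 := (hu.laplacian hS).hasDerivWithinAt_slice ht x
    rwa [Torus.timeDerivWithin_laplacian_comm hab hu ht x] at h1
  have hG : HasDerivWithinAt (fun s => Torus.gradient (p s) x)
      (Torus.gradient (Torus.timeDerivWithin S p t) x) S t := by
    have h1 := (hp.gradient hS).hasDerivWithinAt_slice ht x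
    rwa [Torus.timeDerivWithin_gradient_comm hab hp ht x] at h1
  have hF : HasDerivWithinAt (fun s => f s x) (Torus.timeDerivWithin S f t x) S t :=
    hf.hasDerivWithinAt_slice ht x
  have hC : HasDerivWithinAt (fun s => Torus.convect (u s) (u s) x)
      (Torus.convect (w t) (u t) x + Torus.convect (u t) (w t) x) S t := by
    have h1 := (hu.convect hu hS).hasDerivWithinAt_slice ht x
    rwa [Torus.timeDerivWithin_convect hab hu hu ht x] at h1
  have hR : HasDerivWithinAt (fun s => ν • Torus.laplacian (u s) x - Torus.gradient (p s) x + f s x -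
      Torus.convect (u s) (u s) x)
      (ν • Torus.laplacian (w t) x - Torus.gradient (Torus.timeDerivWithin S p t) x +
        Torus.timeDerivWithin S f t x - (Torus.convect (w t) (u t) x + Torus.convect (u t) (w t) x)) S t :=
    (((hL.const_smul ν).sub hG).add hF).sub hC
  -- `w(s, x)` equals that right-hand side for `s ∈ S` (momentum equation)
  have heq : ∀ s ∈ S, w s x = ν • Torus.laplacian (u s) x - Torus.gradient (p s) x + f s x -
      Torus.convect (u s) (u s) x := by
    intro s hs
    rw [hwdef, eq_sub_iff_add_eq]
    exact h.momentum s hs x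
  have hW : HasDerivWithinAt (fun s => w s x)
      (ν • Torus.laplacian (w t) x - Torus.gradient (Torus.timeDerivWithin S p t) x +
        Torus.timeDerivWithin S f t x - (Torus.convect (w t) (u t) x + Torus.convect (u t) (w t) x)) S t :=
    hR.congr (fun s hs => heq s hs) (heq t ht)
  have hd : Torus.timeDerivWithin S w t x = ν • Torus.laplacian (w t) x -
      Torus.gradient (Torus.timeDerivWithin S p t) x + Torus.timeDerivWithin S f t x -
        (Torus.convect (w t) (u t) x + Torus.convect (u t) (w t) x) :=
    hW.derivWithin (hS t ht)
  rw [hd]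
  abel

/-- **Steady force: `∂ₜu` solves the homogeneous linearised equation.** For a classical solution
on `[a, b] × T^d` with a time-independent force `F`, `a < b`, `w = ∂ₜu` and `q = ∂ₜp` satisfy
`∂ₜw + (u·∇)w + (w·∇)u = νΔw − ∇q` on `[a, b] × T^d`. [folklore] -/
theorem _root_.Literature.Analysis.FunctionSpaces.Torus.IsClassicalNSSolutionOn.linearised_timeDerivWithin_of_steady
    {F : UnitAddTorus d → EuclideanSpace ℝ d} (h : Torus.IsClassicalNSSolutionOn (Icc a b) ν (fun _ => F) u p)
    (hab : a < b) {t : ℝ} (ht : t ∈ Icc a b) (x : UnitAddTorus d) :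
    Torus.timeDerivWithin (Icc a b) (Torus.timeDerivWithin (Icc a b) u) t x +
        Torus.convect (u t) (Torus.timeDerivWithin (Icc a b) u t) x +
        Torus.convect (Torus.timeDerivWithin (Icc a b) u t) (u t) x =
      ν • Torus.laplacian (Torus.timeDerivWithin (Icc a b) u t) x -
        Torus.gradient (Torus.timeDerivWithin (Icc a b) p t) x := by
  have h0 : Torus.timeDerivWithin (Icc a b) (fun _ : ℝ => F) t x = 0 := by
    unfold Torus.timeDerivWithin
    exact congrFun (derivWithin_fun_const (c := F x) (s := Icc a b)) t
  rw [h.linearised_timeDerivWithin hab ht x, h0, add_zero]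

/-- **`∂ₜu` is a classical solution of the linearised system (steady force), all clauses.** For a
classical solution on `[a, b] × T^d` with a time-independent force and mean-zero velocity slices,
`a < b`: `w = ∂ₜu` and `q = ∂ₜp` are jointly smooth on `[a, b] × T^d`, `w(t)` is divergence free
and has zero mean, and `∂ₜw + (u·∇)w + (w·∇)u = νΔw − ∇q` — the flow direction solves the first
variation equation. [cite: ConstantinFoiasNSE1988, Ch. 10] -/
theorem _root_.Literature.Analysis.FunctionSpaces.Torus.IsClassicalNSSolutionOn.timeDerivWithin_isLinearised_of_steady
    {F : UnitAddTorus d → EuclideanSpace ℝ d} (h : Torus.IsClassicalNSSolutionOn (Icc a b) ν (fun _ => F) u p)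
    (hab : a < b) (hmean : ∀ t ∈ Icc a b, Torus.HasZeroMean (u t)) :
    Torus.IsSmoothSpaceTimeOn (Icc a b) (Torus.timeDerivWithin (Icc a b) u) ∧
      Torus.IsSmoothSpaceTimeOn (Icc a b) (Torus.timeDerivWithin (Icc a b) p) ∧
      (∀ t ∈ Icc a b, Torus.IsDivFree (Torus.timeDerivWithin (Icc a b) u t)) ∧
      (∀ t ∈ Icc a b, Torus.HasZeroMean (Torus.timeDerivWithin (Icc a b) u t)) ∧
      ∀ t ∈ Icc a b, ∀ x,
        Torus.timeDerivWithin (Icc a b) (Torus.timeDerivWithin (Icc a b) u) t x +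
            Torus.convect (u t) (Torus.timeDerivWithin (Icc a b) u t) x +
            Torus.convect (Torus.timeDerivWithin (Icc a b) u t) (u t) x =
          ν • Torus.laplacian (Torus.timeDerivWithin (Icc a b) u t) x -
            Torus.gradient (Torus.timeDerivWithin (Icc a b) p t) x :=
  ⟨h.smooth_velocity.timeDerivWithin (uniqueDiffOn_Icc hab),
    h.smooth_pressure.timeDerivWithin (uniqueDiffOn_Icc hab),
    fun _ ht => h.isDivFree_timeDerivWithin hab ht,
    fun _ ht => h.smooth_velocity.hasZeroMean_timeDerivWithin hab hmean ht,
    fun _ ht x => h.linearised_timeDerivWithin_of_steady hab ht x⟩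

end NS

end Literature.Analysis.FluidPDE

end
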